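import Literature.Analysis.FluidPDE.FiniteFourierModeEulerPair

/-!
# Kishimoto–Yoneda, §4: Beltrami vectors (Def. 4.2 (ii), Remark 4.3, Lemma 1.2)

Support file for `FiniteFourierModeEuler` (N. Kishimoto, T. Yoneda, J. Math. Fluid Mech. 24
(2022) 74 = arXiv:2110.08039). For `KY.IsBV μ n u` (`u ≠ 0`, `n·u = 0`, `i (n × u) = μ u`, i.e.
`u` is `BV⁺` at `n` if `μ = |n|`, `BV⁻` if `μ = -|n|`), all PROVED:

* in the frame `(p, k)` of `FiniteFourierModeEulerPair`, `α p + β k` is `BV` with eigenvalue `μ`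
  iff `α ≠ 0`, `β = iμα`, `μ² = |n|²` (`isBV_frame_iff`; this is Lemma 1.2 (ii) / Def. 4.2 (ii)(a),(b):
  `|Re u| = |Im u|`, `Re u ⊥ Im u`, handedness = sign of `μ`);
* `μ² = |n|²` (`IsBV.sq_eq`, Lemma 1.2 (i)), `μ ≠ 0`;
* invariance under `u ↦ c u`, `c ≠ 0` (Remark 4.3 (iv)) and under `(n, u) ↦ (-n, ū)` with the SAME
  `μ` (real-valuedness, Remark 4.3 (iii));
* two Beltrami vectors with the same eigenvalue never interact (`IsBV.nonInteracting`, the remark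
  before Prop. 4.8), and non-interaction transports the Beltrami property along a pair of
  independent frequencies (`IsBV.transport`, Remark 4.3 (iv) with Prop. 2.2 (iii)).

## References

* [KishimotoYoneda2022] N. Kishimoto, T. Yoneda, J. Math. Fluid Mech. 24 (2022) 74 =
  arXiv:2110.08039, §1 Lemma 1.2, §4 Def. 4.2 (ii), Remark 4.3 (iii),(iv), paragraph before Prop. 4.8.
-/

noncomputable section

open Matrix

namespace Literature.Analysis.FluidPDE

namespace KY

/-! ### Beltrami vectors in the frame -/

/-- The curl operator `i n ×` in the frame at `n₁`: `i n₁ × (α p₁ + β k) = (-iβ) p₁ + (i α |n₁|²) k`.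
[cite: KishimotoYoneda2022, §4 Def. 4.2 (ii) with Lemma 1.2] -/
theorem curl_frame₁ (n₁ n₂ : Fin 3 → ℝ) (α β : ℂ) :
    Complex.I • (cplx n₁ ⨯₃ (α • cplx ((n₁ ⨯₃ n₂) ⨯₃ n₁) + β • cplx (n₁ ⨯₃ n₂)))
      = (-Complex.I * β) • cplx ((n₁ ⨯₃ n₂) ⨯₃ n₁)
        + (Complex.I * α * ((n₁ ⬝ᵥ n₁ : ℝ) : ℂ)) • cplx (n₁ ⨯₃ n₂) := by
  rw [vec3_eq_iff]
  simp only [real_dot_eq, cplx_apply, cross_apply, Pi.add_apply, 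
      Pi.smul_apply, smul_eq_mul, Matrix.cons_val_zero, Matrix.cons_val_one,
      Matrix.head_cons, Matrix.cons_val_two, Matrix.tail_cons, 
      Fin.isValue]
  push_cast
  refine ⟨?_, ?_, ?_⟩ <;> ring

/-- The curl operator in the frame at `n₂`: `i n₂ × (α p₂ + β k) = (-iβ) p₂ + (i α |n₂|²) k`.
[cite: KishimotoYoneda2022, §4 Def. 4.2 (ii) with Lemma 1.2] -/
theorem curl_frame₂ (n₁ n₂ : Fin 3 → ℝ) (α β : ℂ) :
    Complex.I • (cplx n₂ ⨯₃ (α • cplx ((n₁ ⨯₃ n₂) ⨯₃ n₂) + β • cplx (n₁ ⨯₃ n₂)))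
      = (-Complex.I * β) • cplx ((n₁ ⨯₃ n₂) ⨯₃ n₂)
        + (Complex.I * α * ((n₂ ⬝ᵥ n₂ : ℝ) : ℂ)) • cplx (n₁ ⨯₃ n₂) := by
  rw [vec3_eq_iff]
  simp only [real_dot_eq, cplx_apply, cross_apply, Pi.add_apply, 
      Pi.smul_apply, smul_eq_mul, Matrix.cons_val_zero, Matrix.cons_val_one,
      Matrix.head_cons, Matrix.cons_val_two, Matrix.tail_cons, 
      Fin.isValue]
  push_cast
  refine ⟨?_, ?_, ?_⟩ <;> ring

/-- **Beltrami vectors in the frame (first frequency).** `α p₁ + β k` is `BV` at `n₁` with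
eigenvalue `μ` iff `α ≠ 0`, `β = i μ α` and `μ² = |n₁|²` (paper: `|Re u| = |Im u|`, `Re u ⊥ Im u`,
handedness = sign of `μ`). [cite: KishimotoYoneda2022, §4 Def. 4.2 (ii), Lemma 1.2] -/
theorem isBV_frame_iff₁ {n₁ n₂ : Fin 3 → ℝ} (hk : n₁ ⨯₃ n₂ ≠ 0) (μ : ℝ) {α β : ℂ} {u : Fin 3 → ℂ}
    (hu : u = α • cplx ((n₁ ⨯₃ n₂) ⨯₃ n₁) + β • cplx (n₁ ⨯₃ n₂)) :
    IsBV μ n₁ u ↔ α ≠ 0 ∧ β = Complex.I * μ * α ∧ μ ^ 2 = n₁ ⬝ᵥ n₁ := by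
  have hI : Complex.I ≠ 0 := Complex.I_ne_zero
  constructor
  · rintro ⟨hne, -, heq⟩
    rw [hu, curl_frame₁, smul_add, smul_smul, smul_smul, frame_eq_iff₁ hk] at heq
    obtain ⟨e1, e2⟩ := heq
    have hb : β = Complex.I * μ * α := by linear_combination Complex.I * e1 + β * Complex.I_sq
    have ha : α ≠ 0 := by
      rintro rfl
      rw [mul_zero] at hb
      exact hne (by rw [hu, hb]; simp)
    refine ⟨ha, hb, ?_⟩
    rw [hb] at e2
    have : Complex.I * α * (((n₁ ⬝ᵥ n₁ : ℝ) : ℂ) - (μ : ℂ) ^ 2) = 0 := by linear_combination e2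
    have := (mul_eq_zero.1 this).resolve_left (mul_ne_zero hI ha)
    exact_mod_cast (sub_eq_zero.1 this).symm
  · rintro ⟨ha, hb, hμ⟩
    refine ⟨?_, by rw [hu]; exact dot_frame₁ n₁ n₂ α β, ?_⟩
    · rw [hu, Ne, frame_eq_zero_iff₁ hk]; exact fun h => ha h.1
    · rw [hu, curl_frame₁, smul_add, smul_smul, smul_smul, frame_eq_iff₁ hk, hb, ← hμ]
      push_cast
      constructor
      · linear_combination (-(μ : ℂ) * α) * Complex.I_sq
      · ring

/-- **Beltrami vectors in the frame (second frequency).** [cite: KishimotoYoneda2022, §4 Def. 4.2 (ii), Lemma 1.2] -/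
theorem isBV_frame_iff₂ {n₁ n₂ : Fin 3 → ℝ} (hk : n₁ ⨯₃ n₂ ≠ 0) (μ : ℝ) {α β : ℂ} {u : Fin 3 → ℂ}
    (hu : u = α • cplx ((n₁ ⨯₃ n₂) ⨯₃ n₂) + β • cplx (n₁ ⨯₃ n₂)) :
    IsBV μ n₂ u ↔ α ≠ 0 ∧ β = Complex.I * μ * α ∧ μ ^ 2 = n₂ ⬝ᵥ n₂ := by
  have hI : Complex.I ≠ 0 := Complex.I_ne_zero
  constructor
  · rintro ⟨hne, -, heq⟩
    rw [hu, curl_frame₂, smul_add, smul_smul, smul_smul, frame_eq_iff₂ hk] at heq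
    obtain ⟨e1, e2⟩ := heq
    have hb : β = Complex.I * μ * α := by linear_combination Complex.I * e1 + β * Complex.I_sq
    have ha : α ≠ 0 := by
      rintro rfl
      rw [mul_zero] at hb
      exact hne (by rw [hu, hb]; simp)
    refine ⟨ha, hb, ?_⟩
    rw [hb] at e2
    have : Complex.I * α * (((n₂ ⬝ᵥ n₂ : ℝ) : ℂ) - (μ : ℂ) ^ 2) = 0 := by linear_combination e2
    have := (mul_eq_zero.1 this).resolve_left (mul_ne_zero hI ha)
    exact_mod_cast (sub_eq_zero.1 this).symm
  · rintro ⟨ha, hb, hμ⟩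
    refine ⟨?_, by rw [hu]; exact dot_frame₂ n₁ n₂ α β, ?_⟩
    · rw [hu, Ne, frame_eq_zero_iff₂ hk]; exact fun h => ha h.1
    · rw [hu, curl_frame₂, smul_add, smul_smul, smul_smul, frame_eq_iff₂ hk, hb, ← hμ]
      push_cast
      constructor
      · linear_combination (-(μ : ℂ) * α) * Complex.I_sq
      · ring

/-- `μ² = |n|²` for a Beltrami vector (Lemma 1.2 (i): the support lies on the sphere of radius
`|λ|`). [cite: KishimotoYoneda2022, §1 Lemma 1.2 (i)] -/
theorem IsBV.sq_eq {μ : ℝ} {n : Fin 3 → ℝ} {u : Fin 3 → ℂ} (h : IsBV μ n u) (hn : n ≠ 0) :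
    μ ^ 2 = n ⬝ᵥ n := by
  -- choose an auxiliary frequency `n₂` with `n × n₂ ≠ 0` and read off the frame characterisation
  have key : ∃ n₂ : Fin 3 → ℝ, n ⨯₃ n₂ ≠ 0 := by
    by_contra hall
    simp only [not_exists, not_not] at hall
    have h0 := hall ![1, 0, 0]
    have h1 := hall ![0, 1, 0]
    simp only [cross_apply, Matrix.cons_val_zero, Matrix.cons_val_one, Matrix.head_cons,
      Matrix.cons_val_two, Matrix.tail_cons, mul_one, mul_zero, sub_zero, zero_sub,
      Matrix.cons_eq_zero_iff, neg_eq_zero, Matrix.zero_empty, and_true, true_and] at h0 h1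
    apply hn; ext i; fin_cases i
    · exact h1.2
    · exact h0.2
    · exact h0.1
  obtain ⟨n₂, hk⟩ := key
  obtain ⟨α, β, hu⟩ := exists_frame₁ hk h.dot_eq_zero
  exact ((isBV_frame_iff₁ hk μ hu).1 h).2.2

/-- A Beltrami vector at a non-zero frequency has non-zero eigenvalue. [cite: KishimotoYoneda2022, §1 Lemma 1.2] -/
theorem IsBV.mu_ne_zero {μ : ℝ} {n : Fin 3 → ℝ} {u : Fin 3 → ℂ} (h : IsBV μ n u) (hn : n ≠ 0) :
    μ ≠ 0 := by
  intro hμ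
  have := h.sq_eq hn
  rw [hμ] at this
  exact hn (dotProduct_self_eq_zero.1 (by simpa using this.symm))

/-- Scaling a Beltrami vector by a non-zero complex number (Remark 4.3 (iv): "`BV^±` at `n` is
invariant under multiplication by non-zero complex number"). [cite: KishimotoYoneda2022, §4 Remark 4.3 (iv)] -/
theorem IsBV.smul {μ : ℝ} {n : Fin 3 → ℝ} {u : Fin 3 → ℂ} (h : IsBV μ n u) {c : ℂ} (hc : c ≠ 0) :
    IsBV μ n (c • u) := by
  refine ⟨smul_ne_zero hc h.ne_zero, by rw [dot_smul_right, h.dot_eq_zero, mul_zero], ?_⟩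
  rw [LinearMap.map_smul, smul_comm, h.eq, smul_comm]

/-- Real-valuedness: if `u` is `BV` at `n` with eigenvalue `μ` then `ū` is `BV` at `-n` with the
SAME eigenvalue (so `u_{-n} = ū_n` has the same Beltrami sign). [cite: KishimotoYoneda2022, §4 Remark 4.3 (iii)] -/
theorem IsBV.star_neg {μ : ℝ} {n : Fin 3 → ℝ} {u : Fin 3 → ℂ} (h : IsBV μ n u) :
    IsBV μ (-n) (star u) := by
  obtain ⟨hne, hdot, heq⟩ := h
  refine ⟨by simpa using hne, ?_, ?_⟩
  · have := congrArg (starRingEnd ℂ) hdot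
    simp only [dot_eq, cplx_apply, map_add, map_mul, Complex.conj_ofReal, map_zero] at this
    simp only [dot_eq, cplx_apply, Pi.neg_apply, Complex.ofReal_neg, Pi.star_apply, Complex.star_def]
    linear_combination -this
  · rw [vec3_eq_iff] at heq ⊢
    obtain ⟨e0, e1, e2⟩ := heq
    have c0 := congrArg (starRingEnd ℂ) e0
    have c1 := congrArg (starRingEnd ℂ) e1
    have c2 := congrArg (starRingEnd ℂ) e2
    simp only [cplx_apply, cross_apply, Pi.smul_apply, smul_eq_mul, Matrix.cons_val_zero,
      Matrix.cons_val_one, Matrix.head_cons, Matrix.cons_val_two, Matrix.tail_cons, map_mul, map_sub,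
      Complex.conj_ofReal, Complex.conj_I] at c0 c1 c2
    simp only [cplx_apply, cross_apply, Pi.smul_apply, Pi.neg_apply, Pi.star_apply, smul_eq_mul,
      Matrix.cons_val_zero, Matrix.cons_val_one, Matrix.head_cons, Matrix.cons_val_two,
      Matrix.tail_cons, Complex.ofReal_neg, Complex.star_def]
    exact ⟨by linear_combination c0, by linear_combination c1, by linear_combination c2⟩

/-- **Two Beltrami vectors with the same eigenvalue never interact** (the observation before
Proposition 4.8: same size `|n₁| = |n₂| = |μ|` and both `BV⁺` or both `BV⁻` give (i) or (iii) of
Prop. 2.2). [cite: KishimotoYoneda2022, §4 (paragraph before Prop. 4.8)] -/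
theorem IsBV.nonInteracting {μ : ℝ} {n₁ n₂ : Fin 3 → ℝ} {u₁ u₂ : Fin 3 → ℂ}
    (h₁ : IsBV μ n₁ u₁) (h₂ : IsBV μ n₂ u₂) (hn₁ : n₁ ≠ 0) (hn₂ : n₂ ≠ 0) :
    NonInteracting n₁ n₂ u₁ u₂ := by
  by_cases hk : n₁ ⨯₃ n₂ = 0
  · exact nonInteracting_of_cross_eq_zero hn₁ hn₂ hk h₁.dot_eq_zero h₂.dot_eq_zero
  obtain ⟨α₁, β₁, hu₁⟩ := exists_frame₁ hk h₁.dot_eq_zero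
  obtain ⟨α₂, β₂, hu₂⟩ := exists_frame₂ hk h₂.dot_eq_zero
  obtain ⟨-, hb₁, hμ₁⟩ := (isBV_frame_iff₁ hk μ hu₁).1 h₁
  obtain ⟨-, hb₂, hμ₂⟩ := (isBV_frame_iff₂ hk μ hu₂).1 h₂
  rw [nonInteracting_frame_iff hk hu₁ hu₂, hb₁, hb₂, ← hμ₁, ← hμ₂, sub_self]
  constructor
  · simp
  · ring

/-- **Transport of the Beltrami property (Remark 4.3 (iv)).** If two modes at independent
frequencies do not interact, the first is `BV` with eigenvalue `μ` and the second is non-zero and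
divergence-free, then the second is `BV` with the same eigenvalue (in particular `|n₂| = |n₁|`).
[cite: KishimotoYoneda2022, §4 Remark 4.3 (iv)] -/
theorem IsBV.transport {μ : ℝ} {n₁ n₂ : Fin 3 → ℝ} {u₁ u₂ : Fin 3 → ℂ} (hk : n₁ ⨯₃ n₂ ≠ 0)
    (h₁ : IsBV μ n₁ u₁) (hne₂ : u₂ ≠ 0) (hdiv₂ : dot (cplx n₂) u₂ = 0)
    (h : NonInteracting n₁ n₂ u₁ u₂) : IsBV μ n₂ u₂ := by
  obtain ⟨α₁, β₁, hu₁⟩ := exists_frame₁ hk h₁.dot_eq_zero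
  obtain ⟨α₂, β₂, hu₂⟩ := exists_frame₂ hk hdiv₂
  obtain ⟨ha₁, hb₁, hμ₁⟩ := (isBV_frame_iff₁ hk μ hu₁).1 h₁
  obtain ⟨⟨γ, hγ, hγa, hγb⟩, hnn⟩ := nonInteracting_transport hk hu₁ hu₂ h₁.ne_zero hne₂ h
  rw [isBV_frame_iff₂ hk μ hu₂]
  refine ⟨by rw [hγa]; exact mul_ne_zero hγ ha₁, by rw [hγb, hγa, hb₁]; ring, ?_⟩
  rw [hμ₁]; exact hnn ha₁

end KY

end Literature.Analysis.FluidPDE
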